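import Summits.AtomisticToContinuum.HydrodynamicLimit.Theorems.InformationPercolationEngineCollisionRateCoreEquivalence
import Summits.AtomisticToContinuum.HydrodynamicLimit.Theorems.InformationPercolationEngineCollisionRate
import Summits.AtomisticToContinuum.HydrodynamicLimit.Theorems.LambertianContactSwapSwapGapGibbsDomination
import HarnessLib

/-!
# Crux-strategist sketch for `InformationPercolationEngine.CollisionRate` (stmt-AtomisticToContinuum-13481)

planner-cstrat-stmt-AtomisticToContinuum-13481-s1-0, 2026-08-17.  Companion of `STRATEGY-CENSUS.md` (same crux directory):
the TYPED objects the census refers to, farm-checked, with the cheap glue PROVED.  Nothing here is registered as a stub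
(the lead's skeleton `Lines/Sketch.lean` v27 and its stub set {`stub_marginalEnvelopeLG`, `stub_evenTubeTimeStatProbLG`} are
untouched); nothing is a route item; no statement of the route is asserted.

* §1 `T34p` — the lead's open kinetic stub (verbatim the text consumed by the tree transfer
  `Theorems.CollisionRate.collisionRate_of_lanfordEnvelopeR_of_evenTubeTimeStatProb`).
* §2 DECOMPOSITION D3 of the census ("viscous-scale cut"): `T34pMeso` (the kinetic statement read at the sub-viscous
  mesoscale `ℓ_N = (N+1)^{-1/4}`, no `r`) and `MesoMacroTexture` (the same functional at scale `ℓ_N` versus scale `r`: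
  collision-free compactness content), with the PROVED union-bound glue `t34p_of_meso_of_texture` and the by-name
  composition `collisionRate_of_lanfordEnvelopeR_of_meso_of_texture` (through stmt-13677 and the landed RED′/EQV).
* §3 TRANSFER T5 / STRENGTHEN S5 of the census: `EqSuperExpCollarLD` — super-exponential EQUILIBRIUM large deviations of the
  time-integrated mesoscale even tube statistic — and the PROVED transfer `t34pMeso_of_eqSuperExpCollarLD` through the landed
  energy-tilted domination `LambertianContactSwapSwapGapGibbsDomination.exists_localGibbsLaw_dominated` (abstract form:
  `measure_le_of_energyTilted_domination`).  This is the rate-channel twin of the route's own (dead) kick architecture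
  `KickFairRelEquilibrium_of_eqKickTail`; it is NOT registered as a line (census §Transfer T5: its equilibrium stub strictly
  contains the parked WLD-class statement of crux 15177).
* §4 FRAME: `CollisionRatePreShock` (the crux tied to the conjunct's hypotheses, `τ < T`) and the PROVED restriction
  `collisionRatePreShock_of_collisionRate` (the recommended restatement R is a weakening).
-/

noncomputable section

open scoped BigOperators Topology Classical MeasureTheory ProbabilityTheory InnerProductSpace ENNReal
open Filter Set Function MeasureTheory
open Literature.Analysis.FluidPDE Literature.MathematicalPhysics.KineticTheory
open Summit.AtomisticToContinuum.HydrodynamicLimit.Theses.InformationPercolationEngine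

namespace Summit.AtomisticToContinuum.HydrodynamicLimit.Cruxes.CollisionRate.Strategist

/-! ## §1 The lead's open kinetic stub T34p (verbatim) -/

/-- T34p (`Stubs.stub_evenTubeTimeStatProbLG` of `Lines/Sketch.lean` v27; the hypothesis of
`Theorems.CollisionRate.collisionRate_of_lanfordEnvelopeR_of_evenTubeTimeStatProb`, verbatim). [folklore] -/
def T34p : Prop :=
    ∃ η₀ : ℝ, 0 < η₀ ∧ ∀ (a₀ θ₀ : T3 → ℝ) (u₀ : T3 → V3), Continuous a₀ → Continuous θ₀ → Continuous u₀ →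
      (∀ x, 0 < a₀ x) → (∀ x, 0 < θ₀ x) → ∃ σ₀ : ℝ, 0 < σ₀ ∧ ∀ σ : ℝ, 0 < σ → σ < σ₀ →
      ∀ Φ : (N : ℕ) → HardSphereFlow (Torus.geometry (Fin 3)) (hsDiameter σ N) (N + 1),
      ∀ τ : ℝ, 0 < τ → ∀ χ : ℝ × T3 → ℝ, Continuous χ → ∀ g : ℝ → ℝ, Continuous g →
      (∀ x, η₀ ≤ x → g x = 0) →
      ∀ η δ : ℝ, 0 < η → 0 < δ → ∃ r₀ : ℝ, 0 < r₀ ∧ ∀ r : ℝ, 0 < r → r < r₀ →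
      ∃ L₀ : ℝ, ∀ L : ℝ, L₀ ≤ L → ∃ κ₀ : ℝ, 0 < κ₀ ∧ ∀ κ : ℝ, 0 < κ → κ < κ₀ → ∃ N₀ : ℕ, ∀ N : ℕ, N₀ ≤ N →
        localGibbsLaw σ a₀ u₀ θ₀ N (Φ N)
          {z | η < |evenTubeTimeStat σ N (Φ N) τ χ g (fun q : V3 × V3 × V3 => speedCutoff L ‖q.2.2 - q.2.1‖) r κ z|}
          ≤ ENNReal.ofReal δ

/-! ## §2 Decomposition D3 — the viscous-scale cut -/

/-- The sub-viscous mesoscale `ℓ_N = (N+1)^{-1/4}` (the route's default cell sequence for crux 2, rev 12): `ε_N = σ(N+1)^{-1/3} ≪ ℓ_N`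
(`(N+1)ℓ_N³ = (N+1)^{1/4} → ∞` particles per ball) and `ℓ_N ≪ Kn^{1/2} = (N+1)^{-1/6}` (viscous lifetime of sub-`ℓ_N` structures
`ℓ_N² N^{1/3} = N^{-1/6} → 0` macroscopic time). [folklore] -/
def mesoScale (N : ℕ) : ℝ := ((N : ℝ) + 1) ^ (-(1 / 4 : ℝ))

/-- **D-K · `T34pMeso`** — T34p read at the mesoscale: the time-integrated even tube statistic with mollification / cutoff scale
`r := ℓ_N` is small in `LG`-probability (`N → ∞` after `κ → 0` after `L → ∞`; NO macroscopic `r`).  The kinetic (Boltzmann–Enskog)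
content of the crux below the viscous scale; blind to every structure of scale `≥ ℓ_N`. OPEN. [folklore] -/
def T34pMeso : Prop :=
    ∃ η₀ : ℝ, 0 < η₀ ∧ ∀ (a₀ θ₀ : T3 → ℝ) (u₀ : T3 → V3), Continuous a₀ → Continuous θ₀ → Continuous u₀ →
      (∀ x, 0 < a₀ x) → (∀ x, 0 < θ₀ x) → ∃ σ₀ : ℝ, 0 < σ₀ ∧ ∀ σ : ℝ, 0 < σ → σ < σ₀ →
      ∀ Φ : (N : ℕ) → HardSphereFlow (Torus.geometry (Fin 3)) (hsDiameter σ N) (N + 1),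
      ∀ τ : ℝ, 0 < τ → ∀ χ : ℝ × T3 → ℝ, Continuous χ → ∀ g : ℝ → ℝ, Continuous g →
      (∀ x, η₀ ≤ x → g x = 0) →
      ∀ η δ : ℝ, 0 < η → 0 < δ →
      ∃ L₀ : ℝ, ∀ L : ℝ, L₀ ≤ L → ∃ κ₀ : ℝ, 0 < κ₀ ∧ ∀ κ : ℝ, 0 < κ → κ < κ₀ → ∃ N₀ : ℕ, ∀ N : ℕ, N₀ ≤ N →
        localGibbsLaw σ a₀ u₀ θ₀ N (Φ N)
          {z | η < |evenTubeTimeStat σ N (Φ N) τ χ g (fun q : V3 × V3 × V3 => speedCutoff L ‖q.2.2 - q.2.1‖)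
            (mesoScale N) κ z|}
          ≤ ENNReal.ofReal δ

/-- **D-H · `MesoMacroTexture`** — the SAME functional at scale `r` versus at scale `ℓ_N` agree in `LG`-probability (`N → ∞` inside,
`r → 0` last): no density / pair-velocity texture between the mesoscale and the macroscale at positive weight.  Collision-free
(one-particle empirical fields + thin-tube pair counts through a cutoff difference only); two-block / compactness class; carries the
`∀ τ` surplus of the filed crux (post-shock sub-`r` texture, Disproof §3(4b)). OPEN. [folklore] -/
def MesoMacroTexture : Prop :=
    ∃ η₀ : ℝ, 0 < η₀ ∧ ∀ (a₀ θ₀ : T3 → ℝ) (u₀ : T3 → V3), Continuous a₀ → Continuous θ₀ → Continuous u₀ →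
      (∀ x, 0 < a₀ x) → (∀ x, 0 < θ₀ x) → ∃ σ₀ : ℝ, 0 < σ₀ ∧ ∀ σ : ℝ, 0 < σ → σ < σ₀ →
      ∀ Φ : (N : ℕ) → HardSphereFlow (Torus.geometry (Fin 3)) (hsDiameter σ N) (N + 1),
      ∀ τ : ℝ, 0 < τ → ∀ χ : ℝ × T3 → ℝ, Continuous χ → ∀ g : ℝ → ℝ, Continuous g →
      (∀ x, η₀ ≤ x → g x = 0) →
      ∀ η δ : ℝ, 0 < η → 0 < δ → ∃ r₀ : ℝ, 0 < r₀ ∧ ∀ r : ℝ, 0 < r → r < r₀ →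
      ∃ L₀ : ℝ, ∀ L : ℝ, L₀ ≤ L → ∃ κ₀ : ℝ, 0 < κ₀ ∧ ∀ κ : ℝ, 0 < κ → κ < κ₀ → ∃ N₀ : ℕ, ∀ N : ℕ, N₀ ≤ N →
        localGibbsLaw σ a₀ u₀ θ₀ N (Φ N)
          {z | η < |evenTubeTimeStat σ N (Φ N) τ χ g (fun q : V3 × V3 × V3 => speedCutoff L ‖q.2.2 - q.2.1‖) r κ z -
                evenTubeTimeStat σ N (Φ N) τ χ g (fun q : V3 × V3 × V3 => speedCutoff L ‖q.2.2 - q.2.1‖)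
                  (mesoScale N) κ z|}
          ≤ ENNReal.ofReal δ

/-- Union bound for a difference: `{η < |X|} ⊆ {η/2 < |X − Y|} ∪ {η/2 < |Y|}`. [folklore] -/
theorem setOf_lt_abs_subset_union {α : Type*} (X Y : α → ℝ) (η : ℝ) :
    {z | η < |X z|} ⊆ {z | η / 2 < |X z - Y z|} ∪ {z | η / 2 < |Y z|} := by
  intro z hz
  simp only [Set.mem_setOf_eq, Set.mem_union] at hz ⊢
  by_contra h
  push_neg at h
  have h3 : |X z| ≤ |X z - Y z| + |Y z| := by
    calc |X z| = |(X z - Y z) + Y z| := by ring_nf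
      _ ≤ |X z - Y z| + |Y z| := abs_add_le _ _
  linarith [h.1, h.2]

/-- **GLUE (proved) · `T34p ⇐ T34pMeso ∧ MesoMacroTexture`** — union bound with budgets `η/2, δ/2`; thresholds
`η₀ := min`, `σ₀ := min`, `r₀` from the texture, `L₀ := max`, `κ₀ := min`, `N₀ := max`. [folklore] -/
theorem t34p_of_meso_of_texture (hK : T34pMeso) (hH : MesoMacroTexture) : T34p := by
  obtain ⟨η₁, hη₁, HK⟩ := hK
  obtain ⟨η₂, hη₂, HH⟩ := hH
  refine ⟨min η₁ η₂, lt_min hη₁ hη₂, ?_⟩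
  intro a₀ θ₀ u₀ ha hθ hu ha0 hθ0
  obtain ⟨σ₁, hσ₁, HK⟩ := HK a₀ θ₀ u₀ ha hθ hu ha0 hθ0
  obtain ⟨σ₂, hσ₂, HH⟩ := HH a₀ θ₀ u₀ ha hθ hu ha0 hθ0
  refine ⟨min σ₁ σ₂, lt_min hσ₁ hσ₂, ?_⟩
  intro σ hσ hσlt Φ τ hτ χ hχ g hg hg0 η δ hη hδ
  have hσ1 : σ < σ₁ := lt_of_lt_of_le hσlt (min_le_left _ _)
  have hσ2 : σ < σ₂ := lt_of_lt_of_le hσlt (min_le_right _ _)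
  have hg1 : ∀ x, η₁ ≤ x → g x = 0 := fun x hx => hg0 x ((min_le_left _ _).trans hx)
  have hg2 : ∀ x, η₂ ≤ x → g x = 0 := fun x hx => hg0 x ((min_le_right _ _).trans hx)
  have hη2 : 0 < η / 2 := half_pos hη
  have hδ2 : 0 < δ / 2 := half_pos hδ
  obtain ⟨LK, HK⟩ := HK σ hσ hσ1 Φ τ hτ χ hχ g hg hg1 (η / 2) (δ / 2) hη2 hδ2
  obtain ⟨r₀, hr₀, HH⟩ := HH σ hσ hσ2 Φ τ hτ χ hχ g hg hg2 (η / 2) (δ / 2) hη2 hδ2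
  refine ⟨r₀, hr₀, fun r hr hrlt => ?_⟩
  obtain ⟨LH, HH⟩ := HH r hr hrlt
  refine ⟨max LK LH, fun L hL => ?_⟩
  obtain ⟨κK, hκK, HK⟩ := HK L ((le_max_left _ _).trans hL)
  obtain ⟨κH, hκH, HH⟩ := HH L ((le_max_right _ _).trans hL)
  refine ⟨min κK κH, lt_min hκK hκH, fun κ hκ hκlt => ?_⟩
  obtain ⟨NK, HK⟩ := HK κ hκ (lt_of_lt_of_le hκlt (min_le_left _ _))
  obtain ⟨NH, HH⟩ := HH κ hκ (lt_of_lt_of_le hκlt (min_le_right _ _))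
  refine ⟨max NK NH, fun N hN => ?_⟩
  have EK := HK N ((le_max_left _ _).trans hN)
  have EH := HH N ((le_max_right _ _).trans hN)
  set P := localGibbsLaw σ a₀ u₀ θ₀ N (Φ N) with hP
  set X : Config (N + 1) (Fin 3) T3 → ℝ := fun z =>
    evenTubeTimeStat σ N (Φ N) τ χ g (fun q : V3 × V3 × V3 => speedCutoff L ‖q.2.2 - q.2.1‖) r κ z with hX
  set Y : Config (N + 1) (Fin 3) T3 → ℝ := fun z =>
    evenTubeTimeStat σ N (Φ N) τ χ g (fun q : V3 × V3 × V3 => speedCutoff L ‖q.2.2 - q.2.1‖) (mesoScale N) κ z with hY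
  have hsub := setOf_lt_abs_subset_union X Y η
  calc P {z | η < |X z|}
      ≤ P ({z | η / 2 < |X z - Y z|} ∪ {z | η / 2 < |Y z|}) := measure_mono hsub
    _ ≤ P {z | η / 2 < |X z - Y z|} + P {z | η / 2 < |Y z|} := measure_union_le _ _
    _ ≤ ENNReal.ofReal (δ / 2) + ENNReal.ofReal (δ / 2) := add_le_add EH EK
    _ = ENNReal.ofReal δ := by
        rw [← ENNReal.ofReal_add hδ2.le hδ2.le, add_halves]

/-- **THE CUT COMPOSITION (by name).**  `CollisionRate ⇐ LanfordEnvelopeR (stmt-13677) ∧ T34pMeso ∧ MesoMacroTexture`, through the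
landed transfer `Theorems.CollisionRate.collisionRate_of_lanfordEnvelopeR_of_evenTubeTimeStatProb` (RED′ + BR + EQV). [folklore] -/
theorem collisionRate_of_lanfordEnvelopeR_of_meso_of_texture
    (hE : Summit.AtomisticToContinuum.HydrodynamicLimit.Theses.BGEndpointRigidity.LanfordEnvelopeR)
    (hK : T34pMeso) (hH : MesoMacroTexture) : CollisionRate :=
  Summit.AtomisticToContinuum.HydrodynamicLimit.Theorems.CollisionRate.collisionRate_of_lanfordEnvelopeR_of_evenTubeTimeStatProb
    hE (t34p_of_meso_of_texture hK hH)

/-! ## §3 Transfer T5 — equilibrium super-exponential large deviations of the mesoscale collar defect -/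

/-- **`EqSuperExpCollarLD`** — under the HOMOGENEOUS (flow-invariant) canonical laws `G = localGibbsLaw σ ab ub θb N (Φ N)` (all constant
profiles), the event `{η < |evenTubeTimeStat … (ℓ_N) κ|}` of `T34pMeso` has probability `≤ e^{−M(N+1)}` for EVERY rate `M`
(`M` chosen after `σ, Φ, τ, χ, g, η`; then `L₀, κ₀, N₀`).  An EQUILIBRIUM, super-exponential large-deviation statement for the time
average over `[0,τ]` (`≍ τN^{1/3}` mean free times) of a bounded one-time functional read below the viscous scale.  Heuristic rate:
`N·τ/t_life(ℓ_N) ≥ τ N^{7/6}` (sub-`ℓ_N` hydrodynamic modes) resp. `τ N^{4/3}` (contact-layer anomalies); necklace-proof (each ordered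
pair contributes `≤ ((N+1)κ)⁻¹` at each time).  FALSE at any FIXED scale in place of `ℓ_N` (sub-cell modes, the F3 mechanism of crux 2's
Disproof).  No tool: every landed rung-0 fact is static; dynamical LD for the deterministic flow at super-linear speed is
MacroErgodicity-class (census §Transfer T5). OPEN; NOT registered. [folklore] -/
def EqSuperExpCollarLD : Prop :=
    ∃ η₀ : ℝ, 0 < η₀ ∧ ∀ (ab θb : ℝ) (ub : V3), 0 < ab → 0 < θb → ∃ σ₀ : ℝ, 0 < σ₀ ∧ ∀ σ : ℝ, 0 < σ → σ < σ₀ →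
      ∀ Φ : (N : ℕ) → HardSphereFlow (Torus.geometry (Fin 3)) (hsDiameter σ N) (N + 1),
      ∀ τ : ℝ, 0 < τ → ∀ χ : ℝ × T3 → ℝ, Continuous χ → ∀ g : ℝ → ℝ, Continuous g →
      (∀ x, η₀ ≤ x → g x = 0) →
      ∀ η : ℝ, 0 < η → ∀ M : ℝ,
      ∃ L₀ : ℝ, ∀ L : ℝ, L₀ ≤ L → ∃ κ₀ : ℝ, 0 < κ₀ ∧ ∀ κ : ℝ, 0 < κ → κ < κ₀ → ∃ N₀ : ℕ, ∀ N : ℕ, N₀ ≤ N →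
        localGibbsLaw σ (fun _ => ab) (fun _ => ub) (fun _ => θb) N (Φ N)
          {z | η < |evenTubeTimeStat σ N (Φ N) τ χ g (fun q : V3 × V3 × V3 => speedCutoff L ‖q.2.2 - q.2.1‖)
            (mesoScale N) κ z|}
          ≤ ENNReal.ofReal (Real.exp (-(M * ((N : ℝ) + 1))))

/-- **Abstract transfer through an energy-tilted domination** (the measure form of the entropy inequality, KL-free).  If
`P ≤ G·e^{a + bE}` with `b ≥ 0`, `E ≥ 0` measurable and `E_P[E] ≤ m`, then for EVERY set `S` and every level `K > 0`,
`P(S) ≤ e^{a + bK}·G(S) + m/K` (split on `{E ≤ K}`; the non-measurable `S` is replaced by its `G`-measurable hull). [folklore] -/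
theorem measure_le_of_energyTilted_domination {X : Type*} [MeasurableSpace X] {P G : Measure X}
    [IsProbabilityMeasure P] {E : X → ℝ} {a b m : ℝ}
    (hdom : P ≤ G.withDensity (fun z => ENNReal.ofReal (Real.exp (a + b * E z))))
    (hb : 0 ≤ b) (hE0 : ∀ z, 0 ≤ E z) (hEmeas : Measurable E) (hEi : Integrable E P)
    (hEm : ∫ z, E z ∂P ≤ m) {K : ℝ} (hK : 0 < K) (S : Set X) :
    P S ≤ ENNReal.ofReal (Real.exp (a + b * K)) * G S + ENNReal.ofReal (m / K) := by
  -- measurable hull of `S` for `G`, and the energy level set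
  set t : Set X := toMeasurable G S with ht
  have hSt : S ⊆ t := subset_toMeasurable G S
  have htm : MeasurableSet t := measurableSet_toMeasurable G S
  have hGt : G t = G S := measure_toMeasurable S
  set T : Set X := {z | E z ≤ K} with hT
  have hTm : MeasurableSet T := measurableSet_le hEmeas measurable_const
  set C : ℝ≥0∞ := ENNReal.ofReal (Real.exp (a + b * K)) with hC
  -- split
  have hsplit : t ⊆ (t ∩ T) ∪ {z | K ≤ E z} := by
    intro z hz
    by_cases h : E z ≤ K
    · exact Or.inl ⟨hz, h⟩
    · exact Or.inr (le_of_lt (lt_of_not_ge h))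
  -- the dominated part
  have h1 : P (t ∩ T) ≤ C * G S := by
    calc P (t ∩ T) ≤ G.withDensity (fun z => ENNReal.ofReal (Real.exp (a + b * E z))) (t ∩ T) := hdom _
      _ = ∫⁻ z in t ∩ T, ENNReal.ofReal (Real.exp (a + b * E z)) ∂G := withDensity_apply _ (htm.inter hTm)
      _ ≤ ∫⁻ z in t ∩ T, C ∂G := by
          refine setLIntegral_mono' (htm.inter hTm) fun z hz => ?_
          have hzK : E z ≤ K := hz.2
          exact ENNReal.ofReal_le_ofReal (Real.exp_le_exp.2 (by nlinarith))
      _ = C * G (t ∩ T) := setLIntegral_const _ _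
      _ ≤ C * G t := mul_le_mul_left' (measure_mono Set.inter_subset_left) _
      _ = C * G S := by rw [hGt]
  -- the Markov part
  have h2 : P {z | K ≤ E z} ≤ ENNReal.ofReal (m / K) := by
    have hMk := mul_meas_ge_le_integral_of_nonneg (μ := P) (ae_of_all _ hE0) hEi K
    have hreal : P.real {z | K ≤ E z} ≤ m / K := by
      rw [le_div_iff₀ hK, mul_comm]
      exact hMk.trans hEm
    have hfin : P {z | K ≤ E z} ≠ ∞ := measure_ne_top _ _
    calc P {z | K ≤ E z} = ENNReal.ofReal (P.real {z | K ≤ E z}) := by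
          rw [measureReal_def, ENNReal.ofReal_toReal hfin]
      _ ≤ ENNReal.ofReal (m / K) := ENNReal.ofReal_le_ofReal hreal
  calc P S ≤ P t := measure_mono hSt
    _ ≤ P ((t ∩ T) ∪ {z | K ≤ E z}) := measure_mono hsplit
    _ ≤ P (t ∩ T) + P {z | K ≤ E z} := measure_union_le _ _
    _ ≤ C * G S + ENNReal.ofReal (m / K) := add_le_add h1 h2

/-- Arithmetic of the budget: with `K = (2A(N+1) + δ)/δ` and `M = A + 2Ab/δ + 1` the dominated part is `e^{b − (N+1)}`. [folklore] -/
theorem budget_exponent (A b δ n : ℝ) (hδ : 0 < δ) :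
    A * n + b * ((2 * A * n + δ) / δ) + -((A + 2 * A * b / δ + 1) * n) = b - n := by
  field_simp
  ring

/-- **TRANSFER (proved) · `T34pMeso ⇐ EqSuperExpCollarLD`.**  The energy-tilted domination `LG ≤ G_{1,0,1}·e^{A(N+1)+bE}`,
`E_{LG}[E] ≤ A(N+1)` (`exists_localGibbsLaw_dominated`, landed, all `σ ≤ 1/2`) and `measure_le_of_energyTilted_domination` with
`K := (2A(N+1)+δ)/δ`, `M := A + 2Ab/δ + 1`: `LG(S) ≤ e^{b−(N+1)} + δ/2 ≤ δ` for `N + 1 ≥ b − log(δ/2)`. [folklore] -/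
theorem t34pMeso_of_eqSuperExpCollarLD (h : EqSuperExpCollarLD) : T34pMeso := by
  obtain ⟨η₀, hη₀, H⟩ := h
  refine ⟨η₀, hη₀, ?_⟩
  intro a₀ θ₀ u₀ ha hθ hu ha0 hθ0
  obtain ⟨σ₁, hσ₁, H⟩ := H 1 1 (0 : V3) one_pos one_pos
  refine ⟨min σ₁ (1 / 2), lt_min hσ₁ (by norm_num), ?_⟩
  intro σ hσ hσlt Φ τ hτ χ hχ g hg hg0 η δ hη hδ
  have hσ1 : σ < σ₁ := lt_of_lt_of_le hσlt (min_le_left _ _)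
  have hσhalf : σ ≤ 1 / 2 := (lt_of_lt_of_le hσlt (min_le_right _ _)).le
  obtain ⟨A, b, hA, hb, Hdom⟩ :=
    Summit.AtomisticToContinuum.HydrodynamicLimit.Theorems.LambertianContactSwapSwapGapGibbsDomination.exists_localGibbsLaw_dominated
      ha hθ hu ha0 hθ0 hσhalf
  have hδ2 : 0 < δ / 2 := half_pos hδ
  set M : ℝ := A + 2 * A * b / δ + 1 with hM
  obtain ⟨L₀, H⟩ := H σ hσ hσ1 Φ τ hτ χ hχ g hg hg0 η hη M
  refine ⟨L₀, fun L hL => ?_⟩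
  obtain ⟨κ₀, hκ₀, H⟩ := H L hL
  refine ⟨κ₀, hκ₀, fun κ hκ hκlt => ?_⟩
  obtain ⟨N₁, H⟩ := H κ hκ hκlt
  -- `e^{b - (N+1)} ≤ δ/2` eventually
  set N₂ : ℕ := ⌈b - Real.log (δ / 2)⌉₊ with hN₂
  refine ⟨max N₁ N₂, fun N hN => ?_⟩
  have hN1 : N₁ ≤ N := (le_max_left _ _).trans hN
  have hN2 : N₂ ≤ N := (le_max_right _ _).trans hN
  have hGbound := H N hN1
  obtain ⟨hdomN, -, -, hEi, hEm⟩ := Hdom N (Φ N)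
  set P := localGibbsLaw σ a₀ u₀ θ₀ N (Φ N) with hP
  set G := localGibbsLaw σ (fun _ => (1 : ℝ)) (fun _ => (0 : V3)) (fun _ => (1 : ℝ)) N (Φ N) with hG
  haveI : IsProbabilityMeasure P := isProbabilityMeasure_localGibbsLaw ha hθ hu ha0 hθ0 hσhalf N (Φ N)
  have hn : (0 : ℝ) < (N : ℝ) + 1 := by positivity
  set n : ℝ := (N : ℝ) + 1 with hn'
  set K : ℝ := (2 * A * n + δ) / δ with hK
  have hKpos : 0 < K := by
    rw [hK]; positivity
  have hEmeas : Measurable (configEnergy : Config (N + 1) (Fin 3) T3 → ℝ) := by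
    unfold configEnergy
    exact measurable_const.mul
      (Finset.measurable_sum _ fun i _ => ((measurable_pi_apply i).snd).norm.pow_const 2)
  have hE0 : ∀ z : Config (N + 1) (Fin 3) T3, 0 ≤ configEnergy z := fun z => by
    unfold configEnergy
    exact mul_nonneg (by norm_num) (Finset.sum_nonneg fun i _ => sq_nonneg _)
  set S : Set (Config (N + 1) (Fin 3) T3) :=
    {z | η < |evenTubeTimeStat σ N (Φ N) τ χ g (fun q : V3 × V3 × V3 => speedCutoff L ‖q.2.2 - q.2.1‖)
      (mesoScale N) κ z|} with hS
  have hmain := measure_le_of_energyTilted_domination (P := P) (G := G) (S := S) hdomN hb hE0 hEmeas hEi hEm hKpos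
  -- the dominated part: `e^{A n + b K} · e^{-M n} = e^{b - n} ≤ δ/2`
  have hpart1 : ENNReal.ofReal (Real.exp (A * n + b * K)) * G S ≤ ENNReal.ofReal (δ / 2) := by
    calc ENNReal.ofReal (Real.exp (A * n + b * K)) * G S
        ≤ ENNReal.ofReal (Real.exp (A * n + b * K)) * ENNReal.ofReal (Real.exp (-(M * n))) :=
          mul_le_mul_left' hGbound _
      _ = ENNReal.ofReal (Real.exp (A * n + b * K) * Real.exp (-(M * n))) :=
          (ENNReal.ofReal_mul (Real.exp_pos _).le).symm
      _ = ENNReal.ofReal (Real.exp (b - n)) := by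
          rw [← Real.exp_add]
          congr 2
          rw [hK, hM]
          exact budget_exponent A b δ n hδ
      _ ≤ ENNReal.ofReal (δ / 2) := by
          refine ENNReal.ofReal_le_ofReal ?_
          have hceil : b - Real.log (δ / 2) ≤ (N₂ : ℝ) := Nat.le_ceil _
          have hN2' : (N₂ : ℝ) ≤ (N : ℝ) := by exact_mod_cast hN2
          have hle : b - n ≤ Real.log (δ / 2) := by rw [hn']; linarith
          calc Real.exp (b - n) ≤ Real.exp (Real.log (δ / 2)) := Real.exp_le_exp.2 hle
            _ = δ / 2 := Real.exp_log hδ2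
  -- the Markov part: `A n / K ≤ δ/2`
  have hpart2 : ENNReal.ofReal (A * n / K) ≤ ENNReal.ofReal (δ / 2) := by
    refine ENNReal.ofReal_le_ofReal ?_
    rw [div_le_iff₀ hKpos, hK]
    have h2 : δ / 2 * ((2 * A * n + δ) / δ) = A * n + δ / 2 := by
      rw [div_mul_div_comm, mul_comm δ (2 * A * n + δ), mul_div_mul_right _ _ hδ.ne']
      ring
    rw [h2]
    linarith
  calc P S ≤ ENNReal.ofReal (Real.exp (A * n + b * K)) * G S + ENNReal.ofReal (A * n / K) := hmain
    _ ≤ ENNReal.ofReal (δ / 2) + ENNReal.ofReal (δ / 2) := add_le_add hpart1 hpart2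
    _ = ENNReal.ofReal δ := by rw [← ENNReal.ofReal_add hδ2.le hδ2.le, add_halves]

/-- **The T5 composition (by name, for the record — NOT a registered line):**
`CollisionRate ⇐ LanfordEnvelopeR (13677) ∧ EqSuperExpCollarLD ∧ MesoMacroTexture`. [folklore] -/
theorem collisionRate_of_lanfordEnvelopeR_of_eqSuperExp_of_texture
    (hE : Summit.AtomisticToContinuum.HydrodynamicLimit.Theses.BGEndpointRigidity.LanfordEnvelopeR)
    (hS : EqSuperExpCollarLD) (hH : MesoMacroTexture) : CollisionRate :=
  collisionRate_of_lanfordEnvelopeR_of_meso_of_texture hE (t34pMeso_of_eqSuperExpCollarLD hS) hH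

/-! ## §4 Frame — the crux tied to the conjunct's hypotheses -/

/-- **`CollisionRatePreShock`** (restatement R, recommended by Disproof §3(4b), prover audits A6, lead c4/c8/c9; the rate-channel twin of
the sibling's `EvenStressEnskogPreShock`): the crux in its `evenStat`-at-mark-`1` frame, claimed only for horizons `τ < T` under the
hypotheses of `ChaosClosesEuler`'s conclusion — a classical hard-sphere Euler solution on `[0,T)` whose packing stays below the SAME
`η₀`, and the `t = 0` law of large numbers.  Implied by the filed crux (`collisionRatePreShock_of_collisionRate`); what `closes`
morally consumes. [folklore] -/
def CollisionRatePreShock : Prop :=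
    ∃ η₀ : ℝ, 0 < η₀ ∧ ∀ (a₀ θ₀ : T3 → ℝ) (u₀ : T3 → V3), Continuous a₀ → Continuous θ₀ → Continuous u₀ →
      (∀ x, 0 < a₀ x) → (∀ x, 0 < θ₀ x) → ∃ σ₀ : ℝ, 0 < σ₀ ∧ ∀ σ : ℝ, 0 < σ → σ < σ₀ →
      ∀ (T : ℝ) (ρ θ : ℝ → T3 → ℝ) (u : ℝ → T3 → V3), IsHardSphereEulerSolution σ T ρ u θ →
      (∀ t ∈ Set.Ico 0 T, ∀ x, ρ t x * σ ^ 3 < η₀) →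
      ∀ Φ : (N : ℕ) → HardSphereFlow (Torus.geometry (Fin 3)) (hsDiameter σ N) (N + 1),
      TendstoHydroFieldsAt (fun N => localGibbsLaw σ a₀ u₀ θ₀ N (Φ N)) Φ ρ u θ 0 →
      ∀ τ : ℝ, 0 < τ → τ < T → ∀ χ : ℝ × T3 → ℝ, Continuous χ → ∀ g : ℝ → ℝ, Continuous g →
      (∀ a, η₀ ≤ a → g a = 0) →
      ∀ η δ : ℝ, 0 < η → 0 < δ → ∃ r₀ : ℝ, 0 < r₀ ∧ ∀ r : ℝ, 0 < r → r < r₀ →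
      ∃ N₀ : ℕ, ∀ N : ℕ, N₀ ≤ N →
        localGibbsLaw σ a₀ u₀ θ₀ N (Φ N) {z | η < |evenStat σ N (Φ N) τ χ g (fun _ => 1) r z|}
          ≤ ENNReal.ofReal δ

/-- **R is a weakening (proved):** the filed crux implies its pre-shock restriction (ignore the Euler-solution binders). [folklore] -/
theorem collisionRatePreShock_of_collisionRate (h : CollisionRate) : CollisionRatePreShock := by
  rw [Summit.AtomisticToContinuum.HydrodynamicLimit.Theorems.CollisionRate.collisionRate_iff_evenStat_one] at h
  obtain ⟨η₀, hη₀, H⟩ := h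
  refine ⟨η₀, hη₀, fun a₀ θ₀ u₀ ha hθ hu ha0 hθ0 => ?_⟩
  obtain ⟨σ₀, hσ₀, H⟩ := H a₀ θ₀ u₀ ha hθ hu ha0 hθ0
  refine ⟨σ₀, hσ₀, fun σ hσ hσlt T ρ θ u _ _ Φ _ τ hτ _ χ hχ g hg hg0 η δ hη hδ => ?_⟩
  exact H σ hσ hσlt Φ τ hτ χ hχ g hg hg0 η δ hη hδ

end Summit.AtomisticToContinuum.HydrodynamicLimit.Cruxes.CollisionRate.Strategist

end
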